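import Summits.BirchSwinnertonDyer.Rank1Residual.X11b.SelmerTorsionControl
import Summits.BirchSwinnertonDyer.Rank1Residual.X11b.PontryaginCongruence
import Summits.BirchSwinnertonDyer.Rank1Residual.X11b.FittingOfNoFiniteSubmodulePowerSeries
import HarnessLib

/-!
# X11b, route R1 — erratum Thm. 1.1 ⇐ Thm. 2.3 with "(b) + Lemma 2.1 + Fitting ideals" KERNEL-CHECKED

HONEST FRAMING (cell `b2b-bsdres`, run/shared/lean/b2b/bsd-rank1-residual/, verbatim in every
file): the goal of the cell is to DELETE the COMBINATION-SHAPED residual classes of the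
Birch–Swinnerton-Dyer formula for ALL analytic-rank `≤ 1` elliptic curves over `ℚ` — "full BSD
formula for every rank `≤ 1` curve in class `C`" assembled STRICTLY from published theorems — so
that the rank-`≤ 1` remainder becomes exactly the CONSTRUCTION-SHAPED classes, which are TYPED
(missing-input `Prop`s), NOT attempted. This is not "finishing BSD". Sub-cell
`b2b-bsdres-multr1-p1` (X11b via the re-proof of Castella 2018 Thm. A along the author's erratum):
a RESEARCH ROUTE; no claim beyond the stated class; X11b stays CONSTRUCTION-SHAPED; nothing here
changes a label. THEOREMS ONLY (no definition, no named fact, no `sorry`).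

## Position in route R1

Gens 1–3 of this sub-cell kernel-checked "the same argument as in [Cas18, §5]" (Thm. A′ on
`ChainLocus` from 10 PUBLISHED named facts + the one OPEN input (A) = display (5.3)) and the
commutative algebra of the erratum's proof of Thm. 1.1 from Thm. 2.3 (p. 4, "[Ski16, p. 192]
verbatim": `CongruenceLimit.isTorsion_and_charIdeal_eq_of_congruences`, whose hypothesis `e` —
`X/p^m X ≅ X_m/p^m X_m` for the Pontryagin duals of the Selmer groups of `f` and `g_m` — was an
INPUT labelled "(b) + Lemma 2.1, dualised"). This file DERIVES `e`:

  `Sel(M_f)[a^m] ≅ Sel(M_f[a^m])`      — Lemma 2.1 for `f`   (`TorsionControl.selmerTorsionEquiv`)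
  `          ≅ Sel(M_{g_m}[a^m])`      — (b): `M_{g_m}[a^m] ≅ M_f[a^m]` (`TorsionControl.selmerCongr`)
  `          ≅ Sel(M_{g_m})[a^m]`      — Lemma 2.1 for `g_m`
  `⟹ X/(a)^m X ≅ X_m/(a)^m X_m`        — Pontryagin duality (`PontryaginCongruence.…_of_torsionBy_equiv`)

and feeds it to the skeleton: **`isTorsion_and_charIdeal_eq_of_selmer_congruences`** (any
Noetherian UFD `R = A` of coefficients with `a ∈ Jac(R)`; input `hF m : Fitt(X_m) = (L_m)`) and
**`powerSeries_isTorsion_and_charIdeal_eq_of_selmer_congruences_printed`** (`R = Λ_𝒪 = 𝒪⟦T⟧` for a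
complete DVR `𝒪`; inputs `hT`/`hCh` = Thm. 2.3 for `g_m` and `hnf` = Lemma 2.2 for `g_m` in their
printed form, via gen-3's `PowerSeriesDVR.fittingIdeal_zero_eq_span_of_charIdeal_eq_span_of_forall_length`).

## Dictionary and what remains INPUT (arithmetic; no tree construction today)

* `Γ` with `(φ_v : Γ_v → Γ)_{v}` and constrained set `L`: `G_{K,S}` (`S = Σ ∪ S_p ⊇ ram T`) with
  the decomposition group at `𝔭̄`, `L = {𝔭̄}` [Cas18, §2.1, display in the proof of Thm. 2.6];
* `M_f = T ⊗ Λ_𝒪^*`, `M_{g_m} = T_{g_m} ⊗ Λ_𝒪^*` as discrete `Λ_𝒪`-linear `Γ`-modules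
  (`ContinuousRep Γ R ·`), `a = p` (or `ϖ`); `a`-divisibility (`Λ_𝒪^*` is divisible);
* `h0f/h0g : H⁰(Γ, M) = 0` ("by Shapiro's lemma and the irreducibility of `ρ̄_g|_{G_K}`", footnote 1:
  [Ski20, Lem. 2.8.1]) and `hlocf/hlocg : H⁰(Γ_𝔭̄, M) = 0` (⇐ `H⁰(K_𝔭̄, A_g[ϖ]) = 0` ⇐ (iv)
  `E(ℚ_p)[p] = 0`; reduction to the `ϖ`-torsion: `TorsionControl.invariants_eq_bot_of_torsionBy`);
* `θ m : M_{g_m}[a^m] ≅ M_f[a^m]` — (a)+(b), Hida theory [Ski16, §2.6] (`isoOfLinearEquiv` builds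
  it from an `R`-linear equivariant bijection);
* `[Module.Finite R X]`, `[Module.Finite R X_m]` — cofinite generation of the Selmer groups;
* `hF` / (`hT`, `hCh`, `hnf`) — Thm. 2.3 (⇐ [FW21, Thm. 4.41], PREPRINT: the one unrefereed atom of
  R1) and Lemma 2.2 for `g_m`; `hc` — (c) [Cas20, Thm. 2.11]; `hL` — `L_p(f) ≠ 0` [CV07 + Cas20 5.3].
Output: `X = Sel(M_f)^∨` (`CharacterModule`, `Λ`-action by precomposition as in [Cas18, §2.1]) is
torsion and `char(X) = Fitt(X) = (L)` — Thm. 1.1 for `Σ` over `Λ_𝒪` (the erratum's `Λ_𝒪^{ur}`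
identity is the same algebra over `R₀⟦T⟧`, cf. `CastellaErratumCongruenceLimit.lean`).
NET for route R1: of erratum pp. 2–4, the kernel now holds Lemma 2.1 (this chain) and the whole
p. 4 limiting argument; INPUT remain the objects, Hida (a)+(b), Lemma 2.2 / Thm. 2.3 as statements
about `Sel^Σ_𝔭̄(K_∞, A_{g_m})`, (c), `L_p(f) ≠ 0`, and FW21 4.41 (OPEN). CONDITIONAL on nothing;
deletes nothing; X11b stays CONSTRUCTION-SHAPED.

References: F. Castella, Erratum, §2 [Castella2018Erratum]; C. Skinner, Pacific J. Math. 283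
(2016), §2.6, §3.1 [Skinner2016PacificMC]; F. Castella, Camb. J. Math. 6 (2018), §2 [Castella2018].
-/

noncomputable section

open CategoryTheory Literature.NumberTheory.GaloisRepresentations Literature.RingTheory.FittingIdeal
  Literature.NumberTheory.EllipticCurves.Module
open scoped ContRepresentation

universe u

namespace Summit.BirchSwinnertonDyer.Rank1Residual.X11b.TorsionControl

variable {R : Type u} [CommRing R] [TopologicalSpace R]
variable {Γ : Type u} [Group Γ] [TopologicalSpace Γ] [IsTopologicalGroup Γ]
variable {ι : Type*} {Γv : ι → Type u} [∀ v, Group (Γv v)] [∀ v, TopologicalSpace (Γv v)]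
  [∀ v, IsTopologicalGroup (Γv v)] (φ : ∀ v, Γv v →ₜ* Γ) (L : Set ι)
variable {M : Type u} [AddCommGroup M] [Module R M] [TopologicalSpace M] [DiscreteTopology M]
  [ContinuousSMul R M]

omit [TopologicalSpace R] [TopologicalSpace M] [DiscreteTopology M] [ContinuousSMul R M] in
/-- An `a`-divisible module is `a^m`-divisible. [folklore] -/
theorem surjective_pow_smul (a : R) (h : Function.Surjective fun x : M => a • x) (m : ℕ) :
    Function.Surjective fun x : M => a ^ m • x := by
  induction m with
  | zero => intro x; exact ⟨x, by simp⟩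
  | succ m ih =>
    intro x
    obtain ⟨y, rfl⟩ := h x
    obtain ⟨z, rfl⟩ := ih y
    exact ⟨z, by simp only [pow_succ', mul_smul]⟩

/-- **(b) + Lemma 2.1 ⟹ `Sel(M_f)[a^m] ≃ Sel(M_g)[a^m]`.** For two discrete `R`-linear
`Γ`-modules `M_f`, `M_g` that are `a`-divisible with vanishing global and constrained-local
invariants, an isomorphism of their `a^m`-torsion subrepresentations (input (b)) induces an
`R`-linear isomorphism of the `a^m`-torsion of their Selmer groups (Lemma 2.1 applied to both,
`selmerTorsionEquiv`, and transport along the isomorphism, `selmerCongr`).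
[cite: Castella2018Erratum, Lemma 2.1 and proof of Thm. 1.1 (b)] -/
theorem nonempty_torsionBy_selmer_equiv (a : R) (m : ℕ) {Mf : Type u} [AddCommGroup Mf]
    [Module R Mf] [TopologicalSpace Mf] [DiscreteTopology Mf] [ContinuousSMul R Mf]
    {Mg : Type u} [AddCommGroup Mg] [Module R Mg] [TopologicalSpace Mg] [DiscreteTopology Mg]
    [ContinuousSMul R Mg] (ρf : ContinuousRep Γ R Mf) (ρg : ContinuousRep Γ R Mg)
    (hdivf : Function.Surjective fun x : Mf => a • x) (h0f : ρf.toTopRep.ρ.invariants = ⊥)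
    (hlocf : ∀ v ∈ L, ((ρf.restrict (φ v)).toTopRep).ρ.invariants = ⊥)
    (hdivg : Function.Surjective fun x : Mg => a • x) (h0g : ρg.toTopRep.ρ.invariants = ⊥)
    (hlocg : ∀ v ∈ L, ((ρg.restrict (φ v)).toTopRep).ρ.invariants = ⊥)
    (θ : (torsionRep ρg (a ^ m)).toTopRep ≅ (torsionRep ρf (a ^ m)).toTopRep) :
    Nonempty (Submodule.torsionBy R (selmer φ L ρf) (a ^ m) ≃ₗ[R]
      Submodule.torsionBy R (selmer φ L ρg) (a ^ m)) :=
  ⟨(selmerTorsionEquiv φ L ρf (a ^ m) (surjective_pow_smul a hdivf m)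
        (invariants_divisible_of_eq_bot ρf (a ^ m) h0f)
        (fun v hv => invariants_divisible_of_eq_bot _ (a ^ m) (hlocf v hv))).symm.trans
    ((selmerCongr φ L θ).symm.trans
      (selmerTorsionEquiv φ L ρg (a ^ m) (surjective_pow_smul a hdivg m)
        (invariants_divisible_of_eq_bot ρg (a ^ m) h0g)
        (fun v hv => invariants_divisible_of_eq_bot _ (a ^ m) (hlocg v hv))))⟩

/-- **Erratum Thm. 1.1 ⇐ Thm. 2.3 with the passage "(b) + Lemma 2.1 + basic properties of Fitting
ideals" kernel-checked.** Let `R` be a Noetherian UFD (`Λ_𝒪`) with `a ∈ R` in the Jacobson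
radical (`p` or `ϖ`), `Γ` a topological group with a family of continuous homomorphisms
`φ_v : Γ_v → Γ` and constrained set `L` (the Selmer data: `G_{K,S}` with `L = {𝔭̄}`), `M_f` a
discrete `R`-linear `Γ`-module (`M_f = T ⊗ Λ_𝒪^*`) and `M_{g_m}` (`m ≥ 1`) further ones
(`T_{g_m} ⊗ Λ_𝒪^*`), all `a`-divisible with `H⁰(Γ, ·) = 0` and `H⁰(Γ_v, ·) = 0` for `v ∈ L`
(hypotheses of Lemma 2.1: irreducibility + Shapiro, and (iv)). Write `X = Sel(M_f)^∨`,
`X_m = Sel(M_{g_m})^∨` (character modules = Pontryagin duals of the discrete torsion Selmer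
groups; assumed finitely generated). Given
  `θ m`  — an isomorphism of discrete `Γ`-modules `M_{g_m}[a^m] ≅ M_f[a^m]`            [(b)],
  `hF m` — `Fitt_R(X_m) = (L_m)`                                [Thm. 2.3 + Lemma 2.2 for `g_m`],
  `hc m` — `(L_m) + (a^m) = (L) + (a^m)`                         [(c), [Cas20, Thm. 2.11]],
  `hL`   — `L ≠ 0`                                               [Cornut–Vatsal + [Cas20, 5.3]],
then `X` is `R`-torsion and `char_R(X) = Fitt_R(X) = (L)` (Thm. 1.1 for `Σ`). The congruence
isomorphisms `X/a^m ≅ X_m/a^m` of the skeleton (`CongruenceLimit.isTorsion_and_charIdeal_eq_of_congruences`)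
are now DERIVED: `Sel(M_f)[a^m] ≅ Sel(M_f[a^m]) ≅ Sel(M_{g_m}[a^m]) ≅ Sel(M_{g_m})[a^m]`
(Lemma 2.1 twice + (b)), dualised by `PontryaginCongruence.nonempty_quotIdealPow_equiv_of_torsionBy_equiv`.
[cite: Castella2018Erratum, proof of Thm. 1.1 (p. 4)] [cite: Skinner2016PacificMC, §3.1 (p. 192)] -/
theorem isTorsion_and_charIdeal_eq_of_selmer_congruences [IsNoetherianRing R] [IsDomain R]
    [UniqueFactorizationMonoid R] (a : R) (ha : Ideal.span {a} ≤ (⊥ : Ideal R).jacobson)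
    {Mf : Type u} [AddCommGroup Mf] [Module R Mf] [TopologicalSpace Mf] [DiscreteTopology Mf]
    [ContinuousSMul R Mf] (ρf : ContinuousRep Γ R Mf)
    (hdivf : Function.Surjective fun x : Mf => a • x) (h0f : ρf.toTopRep.ρ.invariants = ⊥)
    (hlocf : ∀ v ∈ L, ((ρf.restrict (φ v)).toTopRep).ρ.invariants = ⊥)
    (Mg : ℕ → Type u) [∀ m, AddCommGroup (Mg m)] [∀ m, Module R (Mg m)]
    [∀ m, TopologicalSpace (Mg m)] [∀ m, DiscreteTopology (Mg m)] [∀ m, ContinuousSMul R (Mg m)]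
    (ρg : ∀ m, ContinuousRep Γ R (Mg m))
    (hdivg : ∀ m, 1 ≤ m → Function.Surjective fun x : Mg m => a • x)
    (h0g : ∀ m, 1 ≤ m → (ρg m).toTopRep.ρ.invariants = ⊥)
    (hlocg : ∀ m, 1 ≤ m → ∀ v ∈ L, (((ρg m).restrict (φ v)).toTopRep).ρ.invariants = ⊥)
    (θ : ∀ m, 1 ≤ m → ((torsionRep (ρg m) (a ^ m)).toTopRep ≅ (torsionRep ρf (a ^ m)).toTopRep))
    [Module.Finite R (CharacterModule (selmer φ L ρf))]
    [∀ m, Module.Finite R (CharacterModule (selmer φ L (ρg m)))]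
    {Lf : R} (hL : Lf ≠ 0) (Lg : ℕ → R)
    (hF : ∀ m, 1 ≤ m →
      Module.fittingIdeal R (CharacterModule (selmer φ L (ρg m))) 0 = Ideal.span {Lg m})
    (hc : ∀ m, 1 ≤ m →
      Ideal.span {Lg m} ⊔ (Ideal.span {a}) ^ m = Ideal.span {Lf} ⊔ (Ideal.span {a}) ^ m) :
    Module.IsTorsion R (CharacterModule (selmer φ L ρf)) ∧
      Module.fittingIdeal R (CharacterModule (selmer φ L ρf)) 0 = Ideal.span {Lf} ∧
      charIdeal R (CharacterModule (selmer φ L ρf)) = Ideal.span {Lf} := by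
  refine CongruenceLimit.isTorsion_and_charIdeal_eq_of_congruences
    (fun m => CharacterModule (selmer φ L (ρg m))) (Ideal.span {a}) ha hL Lg (fun m hm => ?_) hF hc
  exact Classical.choice (PontryaginCongruence.nonempty_quotIdealPow_equiv_of_torsionBy_equiv a m
    (Classical.choice (nonempty_torsionBy_selmer_equiv φ L a m ρf (ρg m) hdivf h0f hlocf
      (hdivg m hm) (h0g m hm) (hlocg m hm) (θ m hm))))

/-! ### Printed inputs over `Λ_𝒪 = 𝒪⟦T⟧` (Thm. 2.3: torsion + `Ch = (L_p(g_m))`; Lemma 2.2: no finite submodule) -/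

section PowerSeries

variable {𝒪 : Type} [CommRing 𝒪] [IsDomain 𝒪] [IsDiscreteValuationRing 𝒪]
  [IsAdicComplete (IsLocalRing.maximalIdeal 𝒪) 𝒪] [TopologicalSpace (PowerSeries 𝒪)]
variable {Γ₀ : Type} [Group Γ₀] [TopologicalSpace Γ₀] [IsTopologicalGroup Γ₀]
variable {ι₀ : Type*} {Γw : ι₀ → Type} [∀ v, Group (Γw v)] [∀ v, TopologicalSpace (Γw v)]
  [∀ v, IsTopologicalGroup (Γw v)] (ψ : ∀ v, Γw v →ₜ* Γ₀) (L₀ : Set ι₀)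

/-- **Erratum Thm. 1.1 ⇐ Thm. 2.3 over `Λ_𝒪 = 𝒪⟦T⟧` (`𝒪` any discrete valuation ring, `a ∈ Λ_𝒪` in
the Jacobson radical, e.g. `a = ϖ` or `p`), ALL inputs in PRINTED form and the passage
"(b) + Lemma 2.1 + Fitting ideals" kernel-checked**: inputs = the discrete `Λ_𝒪`-linear
`Γ`-modules `M_f`, `M_{g_m}` with the Selmer data `(Γ, (ψ_v)_{v ∈ L})` [objects], their
`a`-divisibility and the vanishing of `H⁰(Γ, ·)`, `H⁰(Γ_v, ·)` (`v ∈ L`) [hypotheses of Lemma 2.1: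
irreducibility + Shapiro; (iv)], `θ m : M_{g_m}[a^m] ≅ M_f[a^m]` [(b), Hida theory], finite
generation of the Pontryagin duals, `hT`/`hCh` [Thm. 2.3 for `g_m`], `hnf` [Lemma 2.2 for `g_m`],
`hc` [(c)], `hL` [`L_p(f) ≠ 0`]; output = `X = Sel(M_f)^∨` is `Λ_𝒪`-torsion with
`char(X) = Fitt(X) = (L)`. Universe: everything in `Type` (the tree's `Module.length` /
projective-dimension lemmas behind `hnf ⟹ Fitt = char` live in `ModuleCat.{0}`).
[cite: Castella2018Erratum, Lemma 2.1, Lemma 2.2, Thm. 2.3, proof of Thm. 1.1 (p. 4)] -/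
theorem powerSeries_isTorsion_and_charIdeal_eq_of_selmer_congruences_printed
    (a : PowerSeries 𝒪) (ha : Ideal.span {a} ≤ (⊥ : Ideal (PowerSeries 𝒪)).jacobson)
    {Mf : Type} [AddCommGroup Mf] [Module (PowerSeries 𝒪) Mf] [TopologicalSpace Mf]
    [DiscreteTopology Mf] [ContinuousSMul (PowerSeries 𝒪) Mf] (ρf : ContinuousRep Γ₀ (PowerSeries 𝒪) Mf)
    (hdivf : Function.Surjective fun x : Mf => a • x) (h0f : ρf.toTopRep.ρ.invariants = ⊥)
    (hlocf : ∀ v ∈ L₀, ((ρf.restrict (ψ v)).toTopRep).ρ.invariants = ⊥)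
    (Mg : ℕ → Type) [∀ m, AddCommGroup (Mg m)] [∀ m, Module (PowerSeries 𝒪) (Mg m)]
    [∀ m, TopologicalSpace (Mg m)] [∀ m, DiscreteTopology (Mg m)]
    [∀ m, ContinuousSMul (PowerSeries 𝒪) (Mg m)] (ρg : ∀ m, ContinuousRep Γ₀ (PowerSeries 𝒪) (Mg m))
    (hdivg : ∀ m, 1 ≤ m → Function.Surjective fun x : Mg m => a • x)
    (h0g : ∀ m, 1 ≤ m → (ρg m).toTopRep.ρ.invariants = ⊥)
    (hlocg : ∀ m, 1 ≤ m → ∀ v ∈ L₀, (((ρg m).restrict (ψ v)).toTopRep).ρ.invariants = ⊥)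
    (θ : ∀ m, 1 ≤ m → ((torsionRep (ρg m) (a ^ m)).toTopRep ≅ (torsionRep ρf (a ^ m)).toTopRep))
    [Module.Finite (PowerSeries 𝒪) (CharacterModule (selmer ψ L₀ ρf))]
    [∀ m, Module.Finite (PowerSeries 𝒪) (CharacterModule (selmer ψ L₀ (ρg m)))]
    {Lf : PowerSeries 𝒪} (hL : Lf ≠ 0) (Lg : ℕ → PowerSeries 𝒪)
    (hT : ∀ m, 1 ≤ m → Module.IsTorsion (PowerSeries 𝒪) (CharacterModule (selmer ψ L₀ (ρg m))))
    (hCh : ∀ m, 1 ≤ m →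
      charIdeal (PowerSeries 𝒪) (CharacterModule (selmer ψ L₀ (ρg m))) = Ideal.span {Lg m})
    (hnf : ∀ m, 1 ≤ m → ∀ N' : Submodule (PowerSeries 𝒪) (CharacterModule (selmer ψ L₀ (ρg m))),
      Module.length (PowerSeries 𝒪) N' ≠ ⊤ → N' = ⊥)
    (hc : ∀ m, 1 ≤ m →
      Ideal.span {Lg m} ⊔ (Ideal.span {a}) ^ m = Ideal.span {Lf} ⊔ (Ideal.span {a}) ^ m) :
    Module.IsTorsion (PowerSeries 𝒪) (CharacterModule (selmer ψ L₀ ρf)) ∧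
      Module.fittingIdeal (PowerSeries 𝒪) (CharacterModule (selmer ψ L₀ ρf)) 0 = Ideal.span {Lf} ∧
      charIdeal (PowerSeries 𝒪) (CharacterModule (selmer ψ L₀ ρf)) = Ideal.span {Lf} :=
  isTorsion_and_charIdeal_eq_of_selmer_congruences ψ L₀ a ha ρf hdivf h0f hlocf Mg ρg hdivg h0g hlocg
    θ hL Lg
    (fun m hm => CongruenceLimit.PowerSeriesDVR.fittingIdeal_zero_eq_span_of_charIdeal_eq_span_of_forall_length
      _ (hT m hm) (hnf m hm) (hCh m hm))
    hc

end PowerSeries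

end Summit.BirchSwinnertonDyer.Rank1Residual.X11b.TorsionControl

end
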